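import Summits.QuantumFields.YangMills.Theorems.BalabanUVNodesN15CurvedGluingSmoothCutDressedGluedGauged
import Summits.QuantumFields.YangMills.Theorems.BalabanUVNodesN15CurvedGluingLocalGaugesClose
import HarnessLib

/-!
# N15 = NE2, road (c) — PROGRAMME (PC), towards (PC-B): WALK LOCALITY OF FILE 47's GLUED OPERATOR — the knit of the dressed smooth-cut cubes in per-cube site gauges only feels the data
# near its two arguments: changing the dressings `V̂_□`, the global operator, the far site gauges and the far defects moves it by `[C·(closeness) + C′e^{−(ρ₃∕4−σ)d_Z(y)}]e^{−(ρ₃∕4−2σ)d}`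
# (dag-n15-c g27, n15-c∕293)

Cell `pub-ymgap`, seat `pub-ymgap-dag-n15-c` (generation g27; R134 (a), s1; HUMAN RULING D-0062).  `bears_on: R4∕N15 · K3⁸ SpineGivenEndpointR13SepCoPHV (stmt-QuantumFields-27366)`;
filed `--kind proof --supports stmt-QuantumFields-27366 --as helper` — COUNT-NEUTRAL.  Pure block-majorant algebra; 0 `def`, 0 `sorry`.  Imports FILE 47 `…CurvedGluingSmoothCutDressedGluedGauged`
(`hasMaj_glueInv_smoothCutDressed_localGauges`' per-cube rows: file 34 `hasMaj_smoothCutDressed_loc₂`, `mulOp_comp_smoothCutDressed`, `hasMaj_smoothCut_flat`, `hasMaj_jet_smoothCut_flat`;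
FILE 38 `hasMaj_commOp_cubeOp_smoothCutDressed_in`; file 33 `hasMaj_dressedTail_out`; file 23 `projO_none_dressedV`, `dressedV_comp_eq_self`, `hasMaj_dressedV_pair`, `hasMaj_V_bgPropVE`)
and n15-c∕292 `…CurvedGluingLocalGaugesClose` (`hasMaj_glued_sub_glued_of_localGauges_close`).  Nothing in the tree is modified.

WHY ((PC-B), [B9] (3.95)–(3.96) p.411).  The inverse of `Q′G′²Q′ᵀ(U)` is knitted from FLAT local models `S(𝟙)` in gauges regular on doubled walk cubes; the defect of cube `□` carries
`(G′(U^{w_□}) − G′(𝟙))·1_{near □}`, which must be small WITHOUT a volume factor — i.e. WALK LOCALITY WITH CLOSE DATA between the knit of `U^{w_□}` (site gauges `𝟙` near `□`) and the flat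
knit.  FILE 47 is that knit at the cube level; this file is its two-data version.

WHAT.  §1 `hasMaj_dressedV_sub_base_loc₂` (file 23's currency: `pr₀X̂ − G₀ = G₀(V̂X̂) ≤ 1_S1_S·β(Rβ′c_r)c_r·e^{−ρ₂d}`, two-sided), `hasMaj_smoothCutDressed_sub_loc₂` (file 34's currency: two
dressings `V̂, V̂♭ ≤ R_ce^{−δ_Vd}` (`R_c ≤ R`) of the SAME smooth-cut cube give `M_χ(X − X♭) ≤ 1_S1_S·2β̄(R_cβ̄′c_r)c_r·e^{−ρ₂d}`).  §2 ★★★ `hasMaj_glueInv_sub_glueInv_smoothCutDressed_localGauges_close`: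
FILE 47's hypotheses for two families `(V̂_□, Δ, u_□, F_□)`, `(V̂♭_□, Δ♭, u♭_□, F♭_□)` sharing everything else, `u♭_□ = u_□` and `V̂_□, V̂♭_□ ≤ R_ce^{−δ_Vd}` off `Far`, `S_□ ⊆ Z` on `Far`,
`8σ ≤ ρ₃` ⟹ n15-c∕292's majorant with `β ↦ β̄(1 − β̄Rc_r²)⁻¹`, `θ₀ ↦ θ + θ_F`, `ε ↦ ε₀(1 − ·)⁻¹ + ε_F`, `ε_G ↦ 2β̄(R_cβ̄′c_r)c_r`, `ε_K ↦ 2θ₀`, `ε_E ↦ 2ε`, rate `ρ₃`.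

HONEST FRAMING ∕ LIMITS.  Algebra of glued inverses and Neumann rows; no propagator estimated; [B9] (3.34)–(3.35) p.396, Cor. 3.8 p.410, Thm 3.14 cited for SHAPES ∕ MECHANISM.  NE2⁺ NOT
PRINTED, NOT proved; N15 of record untouched; K3⁸ OPEN; counts UNMOVED.  Restate-immune (no Theses import).
-/

set_option autoImplicit false

noncomputable section
open scoped BigOperators Matrix
open Finset

namespace Summit.QuantumFields.YangMills.BalabanUVNodes.N15.CurvedSpecies

open Literature.MathematicalPhysics.QuantumFieldTheory.Balaban1983to89
open Literature.MathematicalPhysics.QuantumFieldTheory.Balaban1983to89.B11SectG (BlockNorm HasMaj RowSum hasMaj_comp_exp)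
open Literature.MathematicalPhysics.QuantumFieldTheory.Balaban1983to89.B6RandomWalk (Triangle254)
open Literature.MathematicalPhysics.QuantumFieldTheory.Balaban1983to89.B6Prop26Gluing (mulOp mulOp_apply ind ind_nonneg ind_le_one)
open Summit.QuantumFields.YangMills.BalabanUVNodes.N15.MatrixSpecies (mmulOp liftBlk liftEquiv liftEquiv_apply liftEquiv_symm_apply)
open Summit.QuantumFields.YangMills.BalabanUVNodes.N15.BackgroundModel (kappa_ofBlocks)
open Summit.QuantumFields.YangMills.BalabanUVNodes.N15.BackgroundLayer (fgrad bgrad fgradAdj stack projO blkPair bgPropV hasMaj_stack)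
open Summit.QuantumFields.YangMills.BalabanUVNodes.N15.Gluing (commOp lapOp parametrix remainder glueInv hasMaj_localize)

/-! ## §1 Two dressings of one flat cube: the dressed cubes are close -/

section Rows

variable {X ι J : Type} [Fintype X] [DecidableEq X] [Fintype ι] [DecidableEq ι] [Fintype J] [DecidableEq J] {G₀ : (X × ι → ℝ) →ₗ[ℝ] (X × ι → ℝ)}
  {D Dq : J ⊕ J → (X × ι → ℝ) →ₗ[ℝ] (X × ι → ℝ)} {V V' : ((X × ι) × Option (J ⊕ J) → ℝ) →ₗ[ℝ] (X × ι → ℝ)} {g : B6.Geometry} (blk : X → g.Site) (τ : J → X ≃ X) (n : ℝ) {σ cr : ℝ}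
  {N : (X × ι → ℝ) →ₗ[ℝ] (X × ι → ℝ)} {χX χtX ψX : X → ℝ} {S : Set g.Site} {β β₁ ct δ : ℝ}

/-- ★ **THE DRESSING CORRECTION OF ENTRY 0, TWO-SIDED** (file 23's currency): `pr₀X̂ − G₀ = G₀∘(V̂X̂)` (`pr₀X̂ = G₀(1 + V̂X̂)`), so with `G₀ = M_χG₀ = G₀M_ψ` over `S`, `D_j = Dq_j∘G₀`,
`G₀, D_j ≤ βe^{−δd}`, `V̂ ≤ Re^{−δ_Vd}`, file 23's rates and `q = βRc_r² < 1`: `pr₀X̂ − G₀ ≤ 1_S(y)1_S(y′)·β(Rβ(1 − q)⁻¹c_r)c_r·e^{−ρ₂d}`.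
[cite: Balaban1985BackgroundPropagators, (3.63)–(3.65) pp.402–403 (mechanism), Thm 3.14 pp.426–427 (template); Balaban1984PropagatorsII, (2.133) p.247 (shape)] -/
theorem hasMaj_dressedV_sub_base_loc₂ (htri : Triangle254 g) (hd : ∀ a b : g.Site, 0 ≤ g.dist a b) (hrow : RowSum g σ cr) (hσ : 0 ≤ σ) {ρ₁ ρ₂ δ δV β R : ℝ} (hβ : 0 ≤ β)
    (hR : 0 ≤ R) (hcr : 0 ≤ cr) (hσρ : σ ≤ ρ₁) (hρ₁V : ρ₁ ≤ δV) (hρ₁G : ρ₁ + σ ≤ δ) (hρ₂ : 0 ≤ ρ₂) (hρ₂₁ : ρ₂ + σ ≤ ρ₁) {S : Set g.Site} {χX ψX : X → ℝ}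
    (hSχ : ∀ x, χX x ≠ 0 → blk x ∈ S) (hSψ : ∀ x, ψX x ≠ 0 → blk x ∈ S) (hGχ : mulOp (fun p : X × ι => χX p.1) ∘ₗ G₀ = G₀)
    (hGψ : G₀ ∘ₗ mulOp (fun p : X × ι => ψX p.1) = G₀) (hDq : ∀ j, D j = Dq j ∘ₗ G₀)
    (hG : HasMaj (BlockNorm.ofBlocks g (liftBlk blk ι)) (BlockNorm.ofBlocks g (liftBlk blk ι)) G₀ (fun y y' => β * Real.exp (-(δ * g.dist y y'))))
    (hD : ∀ j, HasMaj (BlockNorm.ofBlocks g (liftBlk blk ι)) (BlockNorm.ofBlocks g (liftBlk blk ι)) (D j) (fun y y' => β * Real.exp (-(δ * g.dist y y'))))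
    (hV : HasMaj (BlockNorm.ofBlocks g (blkPair (liftBlk blk ι))) (BlockNorm.ofBlocks g (liftBlk blk ι)) V (fun y y' => R * Real.exp (-(δV * g.dist y y'))))
    (hq : β * (R * cr) * cr < 1) :
    HasMaj (BlockNorm.ofBlocks g (liftBlk blk ι)) (BlockNorm.ofBlocks g (liftBlk blk ι)) (projO none ∘ₗ bgPropV (stack G₀ D) V - G₀)
      (fun y y' => ind S y * ind S y' * (β * (R * (β * (1 - β * (R * cr) * cr)⁻¹) * cr) * cr * Real.exp (-(ρ₂ * g.dist y y')))) := by
  obtain ⟨hunit, -⟩ := hasMaj_dressedV_pair blk htri hd hrow hσ hβ hR hcr hσρ hρ₁V hρ₁G hρ₂ hρ₂₁ hG hD hV hq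
  have hSt := hasMaj_stack (liftBlk blk ι) (fun _ _ => mul_nonneg hβ (Real.exp_nonneg _)) hG hD
  have hVX := hasMaj_V_bgPropVE (liftBlk blk ι) (blkPair (liftBlk blk ι)) htri hd hrow hσ hβ hR hcr hσρ hρ₁V hρ₁G hρ₂ hρ₂₁ hSt hV hq
  have hc : 0 ≤ R * (β * (1 - β * (R * cr) * cr)⁻¹) * cr := mul_nonneg (mul_nonneg hR (mul_nonneg hβ (inv_nonneg.2 (by linarith)))) hcr
  have hρ₂G : ρ₂ + σ ≤ δ := by linarith
  have heq : projO none ∘ₗ bgPropV (stack G₀ D) V - G₀ = G₀ ∘ₗ (V ∘ₗ bgPropV (stack G₀ D) V) := by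
    rw [projO_none_dressedV (G₀ := G₀) (D := D) (V := V) hunit, LinearMap.comp_add, LinearMap.comp_id, add_sub_cancel_left]
  have hinp := dressedV_comp_eq_self (V := V) hDq hGψ
  rw [heq]
  refine hasMaj_localize (liftBlk blk ι) (liftBlk blk ι) (fun a b => mul_nonneg (mul_nonneg (mul_nonneg hβ hc) hcr) (Real.exp_nonneg _)) (fun μ p hp => ?_) (fun μ hμ => ?_)
    ((hasMaj_comp_exp htri hd hrow hβ hc hρ₂ le_rfl hρ₂G hG hVX).mono fun a b => le_of_eq (by rw [kappa_ofBlocks]; ring))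
  · have hχ0 : χX p.1 = 0 := by by_contra h; exact hp (hSχ p.1 h)
    have h1 : (G₀ ∘ₗ (V ∘ₗ bgPropV (stack G₀ D) V)) μ = mulOp (fun p : X × ι => χX p.1) (G₀ ((V ∘ₗ bgPropV (stack G₀ D) V) μ)) := by
      rw [LinearMap.comp_apply, ← LinearMap.comp_apply (mulOp _) G₀, hGχ]
    rw [h1, mulOp_apply, hχ0, zero_mul]
  · rw [LinearMap.comp_apply, LinearMap.comp_apply, ← hinp, LinearMap.comp_apply, mulOp_eq_zero_of_vanish blk hSψ μ hμ, map_zero, map_zero, map_zero]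

/-- ★★ **TWO DRESSINGS OF THE SAME SMOOTH-CUT CUBE ARE CLOSE** (file 34's currency): under file 34 `hasMaj_smoothCutDressed_loc₂`'s hypotheses for the flat cube `N_□`, its bump and
cuts, and TWO perturbations `V̂, V̂♭ ≤ R_ce^{−δ_Vd}`, `R_c ≤ R`, `β̄Rc_r² < 1` (`β̄ = β + (β₁ + c̃β)`): `M_χ(X − X♭) ≤ 1_S(y)1_S(y′)·2β̄(R_cβ̄(1 − β̄Rc_r²)⁻¹c_r)c_r·e^{−ρ₂d}` (the
CLOSENESS RADIUS `R_c` may be much smaller than the Neumann radius `R`) — both `X − M_χ̃N_□` and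
`X♭ − M_χ̃N_□` are §1's corrections, and `M_χX = X`, `M_χX♭ = X♭`. [cite: Balaban1985BackgroundPropagators, (3.63)–(3.65) pp.402–403, Cor. 3.8 p.410 (mechanism); Balaban1984PropagatorsII, (2.133) p.247 (shape)] -/
theorem hasMaj_smoothCutDressed_sub_loc₂ (htri : Triangle254 g) (hd : ∀ a b : g.Site, 0 ≤ g.dist a b) (hrow : RowSum g σ cr) (hσ : 0 ≤ σ) {ρ₁ ρ₂ δV R Rc : ℝ} (hβ : 0 ≤ β)
    (hβ₁ : 0 ≤ β₁) (hct : 0 ≤ ct) (hRc : 0 ≤ Rc) (hRcR : Rc ≤ R) (hcr : 0 ≤ cr) (hσρ : σ ≤ ρ₁) (hρ₁V : ρ₁ ≤ δV) (hρ₁G : ρ₁ + σ ≤ δ) (hρ₂ : 0 ≤ ρ₂) (hρ₂₁ : ρ₂ + σ ≤ ρ₁)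
    (hSχ : ∀ x, χX x ≠ 0 → blk x ∈ S) (hSψ : ∀ x, ψX x ≠ 0 → blk x ∈ S) (hχt : ∀ x, |χtX x| ≤ 1)
    (hdχt : ∀ μ p, |fgrad n (liftEquiv (τ μ) ι) (fun p : X × ι => χtX p.1) p| ≤ ct) (hdχtb : ∀ μ p, |bgrad n (liftEquiv (τ μ) ι) (fun p : X × ι => χtX p.1) p| ≤ ct)
    (hsub : mulOp (fun p : X × ι => χtX p.1) ∘ₗ mulOp (fun p : X × ι => χX p.1) = mulOp (fun p : X × ι => χtX p.1))
    (hχ : mulOp (fun p : X × ι => χX p.1) ∘ₗ mulOp (fun p : X × ι => χtX p.1) = mulOp (fun p : X × ι => χtX p.1))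
    (hs : ∀ μ, mulOp ((fun p : X × ι => χtX p.1) ∘ (liftEquiv (τ μ) ι)) ∘ₗ mulOp (fun p : X × ι => χX p.1) = mulOp ((fun p : X × ι => χtX p.1) ∘ (liftEquiv (τ μ) ι)))
    (hsb : ∀ μ, mulOp ((fun p : X × ι => χtX p.1) ∘ (liftEquiv (τ μ) ι).symm) ∘ₗ mulOp (fun p : X × ι => χX p.1) = mulOp ((fun p : X × ι => χtX p.1) ∘ (liftEquiv (τ μ) ι).symm))
    (hdd : ∀ μ, mulOp (fgrad n (liftEquiv (τ μ) ι) (fun p : X × ι => χtX p.1)) ∘ₗ mulOp (fun p : X × ι => χX p.1) = mulOp (fgrad n (liftEquiv (τ μ) ι) (fun p : X × ι => χtX p.1)))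
    (hddb : ∀ μ, mulOp (bgrad n (liftEquiv (τ μ) ι) (fun p : X × ι => χtX p.1)) ∘ₗ mulOp (fun p : X × ι => χX p.1) = mulOp (bgrad n (liftEquiv (τ μ) ι) (fun p : X × ι => χtX p.1)))
    (hNψ : N ∘ₗ mulOp (fun p : X × ι => ψX p.1) = N)
    (hcut : HasMaj (BlockNorm.ofBlocks g (liftBlk blk ι)) (BlockNorm.ofBlocks g (liftBlk blk ι)) (mulOp (fun p : X × ι => χX p.1) ∘ₗ N)
      (fun y y' => ind S y * ind S y' * (β * Real.exp (-(δ * g.dist y y')))))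
    (hcutF : ∀ μ, HasMaj (BlockNorm.ofBlocks g (liftBlk blk ι)) (BlockNorm.ofBlocks g (liftBlk blk ι)) (mulOp (fun p : X × ι => χX p.1) ∘ₗ (fgrad n (liftEquiv (τ μ) ι) ∘ₗ N))
      (fun y y' => ind S y * ind S y' * (β₁ * Real.exp (-(δ * g.dist y y')))))
    (hcutB : ∀ μ, HasMaj (BlockNorm.ofBlocks g (liftBlk blk ι)) (BlockNorm.ofBlocks g (liftBlk blk ι)) (mulOp (fun p : X × ι => χX p.1) ∘ₗ (bgrad n (liftEquiv (τ μ) ι) ∘ₗ N))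
      (fun y y' => ind S y * ind S y' * (β₁ * Real.exp (-(δ * g.dist y y')))))
    (hV : HasMaj (BlockNorm.ofBlocks g (blkPair (liftBlk blk ι))) (BlockNorm.ofBlocks g (liftBlk blk ι)) V (fun y y' => Rc * Real.exp (-(δV * g.dist y y'))))
    (hV' : HasMaj (BlockNorm.ofBlocks g (blkPair (liftBlk blk ι))) (BlockNorm.ofBlocks g (liftBlk blk ι)) V' (fun y y' => Rc * Real.exp (-(δV * g.dist y y'))))
    (hq : (β + (β₁ + ct * β)) * (R * cr) * cr < 1) :
    HasMaj (BlockNorm.ofBlocks g (liftBlk blk ι)) (BlockNorm.ofBlocks g (liftBlk blk ι))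
      (mulOp (fun p : X × ι => χX p.1) ∘ₗ
        (projO none ∘ₗ bgPropV (stack (mulOp (fun p : X × ι => χtX p.1) ∘ₗ N)
            (fun j => Sum.elim (fun μ => fgrad n (liftEquiv (τ μ) ι)) (fun μ => bgrad n (liftEquiv (τ μ) ι)) j ∘ₗ (mulOp (fun p : X × ι => χtX p.1) ∘ₗ N))) V -
          projO none ∘ₗ bgPropV (stack (mulOp (fun p : X × ι => χtX p.1) ∘ₗ N)
            (fun j => Sum.elim (fun μ => fgrad n (liftEquiv (τ μ) ι)) (fun μ => bgrad n (liftEquiv (τ μ) ι)) j ∘ₗ (mulOp (fun p : X × ι => χtX p.1) ∘ₗ N))) V'))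
      (fun y y' => ind S y * ind S y' * (2 * ((β + (β₁ + ct * β)) * (Rc * ((β + (β₁ + ct * β)) * (1 - (β + (β₁ + ct * β)) * (R * cr) * cr)⁻¹) * cr) * cr) *
        Real.exp (-(ρ₂ * g.dist y y')))) := by
  have hβb : 0 ≤ β + (β₁ + ct * β) := by positivity
  have hle : (β + (β₁ + ct * β)) * (Rc * cr) * cr ≤ (β + (β₁ + ct * β)) * (R * cr) * cr :=
    mul_le_mul_of_nonneg_right (mul_le_mul_of_nonneg_left (mul_le_mul_of_nonneg_right hRcR hcr) hβb) hcr
  have hqc : (β + (β₁ + ct * β)) * (Rc * cr) * cr < 1 := hle.trans_lt hq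
  have hinv : (1 - (β + (β₁ + ct * β)) * (Rc * cr) * cr)⁻¹ ≤ (1 - (β + (β₁ + ct * β)) * (R * cr) * cr)⁻¹ := inv_anti₀ (by linarith) (by linarith)
  have hc : (β + (β₁ + ct * β)) * (Rc * ((β + (β₁ + ct * β)) * (1 - (β + (β₁ + ct * β)) * (Rc * cr) * cr)⁻¹) * cr) * cr ≤
      (β + (β₁ + ct * β)) * (Rc * ((β + (β₁ + ct * β)) * (1 - (β + (β₁ + ct * β)) * (R * cr) * cr)⁻¹) * cr) * cr :=
    mul_le_mul_of_nonneg_right (mul_le_mul_of_nonneg_left (mul_le_mul_of_nonneg_right (mul_le_mul_of_nonneg_left (mul_le_mul_of_nonneg_left hinv hβb) hRc) hcr) hβb) hcr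
  have hG := hasMaj_smoothCut_flat blk (S := S) hβ hβ₁ hct hχt hsub hcut
  have hD := hasMaj_jet_smoothCut_flat blk τ n (S := S) hβ hβ₁ hct hχt hdχt hdχtb hs hsb hdd hddb hcut hcutF hcutB
  have hunit := (hasMaj_dressedV_pair blk htri hd hrow hσ hβb hRc hcr hσρ hρ₁V hρ₁G hρ₂ hρ₂₁ hG hD hV hqc).1
  have hunit' := (hasMaj_dressedV_pair blk htri hd hrow hσ hβb hRc hcr hσρ hρ₁V hρ₁G hρ₂ hρ₂₁ hG hD hV' hqc).1
  have h1 := hasMaj_dressedV_sub_base_loc₂ blk htri hd hrow hσ hβb hRc hcr hσρ hρ₁V hρ₁G hρ₂ hρ₂₁ hSχ hSψ (smoothCut_out hχ) (smoothCut_in hNψ) (fun _ => rfl) hG hD hV hqc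
  have h2 := hasMaj_dressedV_sub_base_loc₂ blk htri hd hrow hσ hβb hRc hcr hσρ hρ₁V hρ₁G hρ₂ hρ₂₁ hSχ hSψ (smoothCut_out hχ) (smoothCut_in hNψ) (fun _ => rfl) hG hD hV' hqc
  rw [LinearMap.comp_sub, mulOp_comp_smoothCutDressed τ n hχ hNψ hunit, mulOp_comp_smoothCutDressed τ n hχ hNψ hunit',
    ← sub_sub_sub_cancel_right _ _ (mulOp (fun p : X × ι => χtX p.1) ∘ₗ N)]
  refine (h1.sub h2).mono fun y y' => ?_
  have hw : 0 ≤ ind S y * ind S y' := mul_nonneg (ind_nonneg _ _) (ind_nonneg _ _)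
  calc ind S y * ind S y' * ((β + (β₁ + ct * β)) * (Rc * ((β + (β₁ + ct * β)) * (1 - (β + (β₁ + ct * β)) * (Rc * cr) * cr)⁻¹) * cr) * cr * Real.exp (-(ρ₂ * g.dist y y'))) +
        ind S y * ind S y' * ((β + (β₁ + ct * β)) * (Rc * ((β + (β₁ + ct * β)) * (1 - (β + (β₁ + ct * β)) * (Rc * cr) * cr)⁻¹) * cr) * cr * Real.exp (-(ρ₂ * g.dist y y')))
      = ind S y * ind S y' * (2 * ((β + (β₁ + ct * β)) * (Rc * ((β + (β₁ + ct * β)) * (1 - (β + (β₁ + ct * β)) * (Rc * cr) * cr)⁻¹) * cr) * cr) * Real.exp (-(ρ₂ * g.dist y y'))) := by ring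
    _ ≤ ind S y * ind S y' * (2 * ((β + (β₁ + ct * β)) * (Rc * ((β + (β₁ + ct * β)) * (1 - (β + (β₁ + ct * β)) * (R * cr) * cr)⁻¹) * cr) * cr) * Real.exp (-(ρ₂ * g.dist y y'))) :=
      mul_le_mul_of_nonneg_left (mul_le_mul_of_nonneg_right (mul_le_mul_of_nonneg_left hc zero_le_two) (Real.exp_nonneg _)) hw

end Rows

/-! ## §2 FILE 47's glued operator: walk locality under a change of dressings, global operator, far gauges and far defects -/

section Glue

variable {X ι J K : Type} [Fintype X] [DecidableEq X] [Fintype ι] [DecidableEq ι] [Fintype J] [DecidableEq J] [Fintype K] {g : B6.Geometry} (blk : X → g.Site) (τ : J → X ≃ X) (n : ℝ)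
  {σ cr : ℝ} {N : K → (X × ι → ℝ) →ₗ[ℝ] (X × ι → ℝ)} {V : K → ((X × ι) × Option (J ⊕ J) → ℝ) →ₗ[ℝ] (X × ι → ℝ)} {Δ W NL : (X × ι → ℝ) →ₗ[ℝ] (X × ι → ℝ)}
  {F : K → (X × ι → ℝ) →ₗ[ℝ] (X × ι → ℝ)} {ug : K → X → Matrix ι ι ℝ} {χX χtX ψX hX : K → X → ℝ} {Sk : K → Set g.Site} {hb : K → g.Site → ℝ} {β β₁ ct δ θF εF : ℝ}
variable {V₂ : K → ((X × ι) × Option (J ⊕ J) → ℝ) →ₗ[ℝ] (X × ι → ℝ)} {Δ₂ : (X × ι → ℝ) →ₗ[ℝ] (X × ι → ℝ)} {F₂ : K → (X × ι → ℝ) →ₗ[ℝ] (X × ι → ℝ)} {ug₂ : K → X → Matrix ι ι ℝ}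
  (Far : K → Prop) [DecidablePred Far] (Z : Set g.Site) (dZ : g.Site → ℝ)

/-- ★★★ **WALK LOCALITY OF FILE 47's GLUED OPERATOR UNDER A CHANGE OF THE DRESSINGS, THE GLOBAL OPERATOR, THE FAR SITE GAUGES AND THE FAR DEFECTS** — FILE 47's hypotheses for ONE set of
flat smooth-cut cubes `N_□`, cuts, partition, tails `T_□`, `W`-letters and commutator letters, and TWO families `(V̂_□, Δ, u_□, F_□)`, `(V̂♭_□, Δ♭, u♭_□, F♭_□)` with the same letters
(`R, δ_V, θ_W, θ_F, ε_F`); `u♭_□ = u_□` on the cubes not `Far`, `S_□ ⊆ Z` on the far cubes, `d_Z` a minorant of the distance to `Z`, `8σ ≤ ρ₃` ⟹ the two glued parametrix inverses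
and both dressings `R_c`-small off `Far` (`R_c ≤ R`) differ by `[C_near + C_far·e^{−(ρ₃∕4−σ)d_Z(y)}]·e^{−(ρ₃∕4−2σ)d}` with `C_near ∝` the closeness letters `2β̄(R_cβ̄′c_r)c_r` (§1), `2θ₀`, `2ε` — n15-c∕292 fed with FILE 47's per-cube rows for both
families.  This is [B9] Cor. 3.8's mechanism for the per-cube-gauge knit: the knit only feels the data near the two arguments. [cite: Balaban1985BackgroundPropagators, (3.34)–(3.35) p.396, Cor. 3.8 p.410, (3.62)–(3.65) pp.402–403, Thm 3.14 pp.426–427 (mechanism); Balaban1984PropagatorsII, (2.91) p.239, (2.133)–(2.136) p.247] -/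
theorem hasMaj_glueInv_sub_glueInv_smoothCutDressed_localGauges_close (htri : Triangle254 g) (hd : ∀ a b : g.Site, 0 ≤ g.dist a b) (hd0 : ∀ y : g.Site, g.dist y y = 0) (hsymm : ∀ y y', g.dist y y' = g.dist y' y) (hdZ : ∀ y z, z ∈ Z → dZ y ≤ g.dist y z) (hdZ0 : ∀ y, 0 ≤ dZ y)
    (hrow : RowSum g σ cr) (hσ : 0 ≤ σ) {ρ₁ ρ₂ ρ₃ ρN ρT δV ε R ε₀ c₁ c₂ θW cN ℓ ω d₁ Nov : ℝ} (hβ : 0 ≤ β) (hβ₁ : 0 ≤ β₁) (hct : 0 ≤ ct) (hR : 0 ≤ R) (hε₀ : 0 ≤ ε₀) (hcr : 0 ≤ cr) (hNov : 0 ≤ Nov) (hσρ : σ ≤ ρ₁) (hρ₁V : ρ₁ ≤ δV)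
    (hρ₁G : ρ₁ + σ ≤ δ) (hρ₂ : 0 ≤ ρ₂) (hρ₂₁ : ρ₂ + σ ≤ ρ₁) (hρ₂T : ρ₂ + σ ≤ ρT) (hρ₃ : 0 ≤ ρ₃) (hρ₃₂ : ρ₃ ≤ ρ₂) (hρ₃V : ρ₃ + σ ≤ δV - ε) (hρ₃N : ρ₃ + σ ≤ ρN) (hσρ₃ : 8 * σ ≤ ρ₃)
    (hε : 0 < ε) (hc₁ : 0 ≤ c₁) (hc₂ : 0 ≤ c₂) (hθW : 0 ≤ θW) (hcN : 0 ≤ cN) (hℓ : 0 ≤ ℓ) (hω : 0 ≤ ω) (hd₁ : 0 ≤ d₁)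
    -- per cube: supports, the bump and its insertions (both ways), the input cut-off
    (hSχ : ∀ k x, χX k x ≠ 0 → blk x ∈ Sk k) (hSψ : ∀ k x, ψX k x ≠ 0 → blk x ∈ Sk k) (hχt : ∀ k x, |χtX k x| ≤ 1)
    (hdχt : ∀ k μ p, |fgrad n (liftEquiv (τ μ) ι) (fun p : X × ι => χtX k p.1) p| ≤ ct) (hdχtb : ∀ k μ p, |bgrad n (liftEquiv (τ μ) ι) (fun p : X × ι => χtX k p.1) p| ≤ ct)
    (hsub : ∀ k, mulOp (fun p : X × ι => χtX k p.1) ∘ₗ mulOp (fun p : X × ι => χX k p.1) = mulOp (fun p : X × ι => χtX k p.1))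
    (hχ : ∀ k, mulOp (fun p : X × ι => χX k p.1) ∘ₗ mulOp (fun p : X × ι => χtX k p.1) = mulOp (fun p : X × ι => χtX k p.1))
    (hs : ∀ k μ, mulOp ((fun p : X × ι => χtX k p.1) ∘ (liftEquiv (τ μ) ι)) ∘ₗ mulOp (fun p : X × ι => χX k p.1) = mulOp ((fun p : X × ι => χtX k p.1) ∘ (liftEquiv (τ μ) ι)))
    (hsb : ∀ k μ, mulOp ((fun p : X × ι => χtX k p.1) ∘ (liftEquiv (τ μ) ι).symm) ∘ₗ mulOp (fun p : X × ι => χX k p.1) = mulOp ((fun p : X × ι => χtX k p.1) ∘ (liftEquiv (τ μ) ι).symm))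
    (hdd : ∀ k μ, mulOp (fgrad n (liftEquiv (τ μ) ι) (fun p : X × ι => χtX k p.1)) ∘ₗ mulOp (fun p : X × ι => χX k p.1) = mulOp (fgrad n (liftEquiv (τ μ) ι) (fun p : X × ι => χtX k p.1)))
    (hddb : ∀ k μ, mulOp (bgrad n (liftEquiv (τ μ) ι) (fun p : X × ι => χtX k p.1)) ∘ₗ mulOp (fun p : X × ι => χX k p.1) = mulOp (bgrad n (liftEquiv (τ μ) ι) (fun p : X × ι => χtX k p.1)))
    (hs' : ∀ k μ, mulOp (fun p : X × ι => χX k p.1) ∘ₗ mulOp ((fun p : X × ι => χtX k p.1) ∘ (liftEquiv (τ μ) ι)) = mulOp ((fun p : X × ι => χtX k p.1) ∘ (liftEquiv (τ μ) ι)))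
    (hsb' : ∀ k μ, mulOp (fun p : X × ι => χX k p.1) ∘ₗ mulOp ((fun p : X × ι => χtX k p.1) ∘ (liftEquiv (τ μ) ι).symm) = mulOp ((fun p : X × ι => χtX k p.1) ∘ (liftEquiv (τ μ) ι).symm))
    (hdd' : ∀ k μ, mulOp (fun p : X × ι => χX k p.1) ∘ₗ mulOp (fgrad n (liftEquiv (τ μ) ι) (fun p : X × ι => χtX k p.1)) = mulOp (fgrad n (liftEquiv (τ μ) ι) (fun p : X × ι => χtX k p.1)))
    (hddb' : ∀ k μ, mulOp (fun p : X × ι => χX k p.1) ∘ₗ mulOp (bgrad n (liftEquiv (τ μ) ι) (fun p : X × ι => χtX k p.1)) = mulOp (bgrad n (liftEquiv (τ μ) ι) (fun p : X × ι => χtX k p.1)))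
    (hNψ : ∀ k, N k ∘ₗ mulOp (fun p : X × ι => ψX k p.1) = N k)
    -- per cube: FILE 63's cut rows
    (hcut : ∀ k, HasMaj (BlockNorm.ofBlocks g (liftBlk blk ι)) (BlockNorm.ofBlocks g (liftBlk blk ι)) (mulOp (fun p : X × ι => χX k p.1) ∘ₗ N k) (fun y y' => ind (Sk k) y * ind (Sk k) y' * (β * Real.exp (-(δ * g.dist y y')))))
    (hcutF : ∀ k μ, HasMaj (BlockNorm.ofBlocks g (liftBlk blk ι)) (BlockNorm.ofBlocks g (liftBlk blk ι)) (mulOp (fun p : X × ι => χX k p.1) ∘ₗ (fgrad n (liftEquiv (τ μ) ι) ∘ₗ N k)) (fun y y' => ind (Sk k) y * ind (Sk k) y' * (β₁ * Real.exp (-(δ * g.dist y y')))))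
    (hcutB : ∀ k μ, HasMaj (BlockNorm.ofBlocks g (liftBlk blk ι)) (BlockNorm.ofBlocks g (liftBlk blk ι)) (mulOp (fun p : X × ι => χX k p.1) ∘ₗ (bgrad n (liftEquiv (τ μ) ι) ∘ₗ N k)) (fun y y' => ind (Sk k) y * ind (Sk k) y' * (β₁ * Real.exp (-(δ * g.dist y y')))))
    -- per cube: the partition (`|h| ≤ 1`, `Σh² = 1`, supported in the cut: `M_hM_χ = M_h`, letters `c₁, c₂`, block reading `hb` with `ℓ, ω`), one-step block distance `d₁`, overlap `N_ov`
    (hhabs : ∀ k x, |hX k x| ≤ 1) (hhcut : ∀ k, mulOp (fun p : X × ι => hX k p.1) ∘ₗ mulOp (fun p : X × ι => χX k p.1) = mulOp (fun p : X × ι => hX k p.1))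
    (hh1 : ∀ k μ p, |fgrad n (liftEquiv (τ μ) ι) (fun p : X × ι => hX k p.1) p| ≤ c₁) (hh1b : ∀ k μ p, |bgrad n (liftEquiv (τ μ) ι) (fun p : X × ι => hX k p.1) p| ≤ c₁) (hh2 : ∀ k μ p, |fgradAdj n (liftEquiv (τ μ) ι) (fgrad n (liftEquiv (τ μ) ι) (fun p : X × ι => hX k p.1)) p| ≤ c₂)
    (hLip : ∀ k y y', |hb k y - hb k y'| ≤ ℓ * g.dist y y') (hrh : ∀ k (p : X × ι), |hX k p.1 - hb k (liftBlk blk ι p)| ≤ ω) (hstep : ∀ μ x, g.dist (blk (τ μ x)) (blk x) ≤ d₁)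
    (hN : ∀ a, ∑ k, ind (Sk k) a ≤ Nov)
    -- per cube: the tail row (dag-n15-a's images geometry ∕ FILE 68's far sandwich)
    (hT : ∀ k, HasMaj (BlockNorm.ofBlocks g (liftBlk blk ι)) (BlockNorm.ofBlocks g (liftBlk blk ι)) ((-(mulOp (fun p : X × ι => hX k p.1) ∘ₗ NL ∘ₗ mulOp (1 - fun p : X × ι => χtX k p.1))) ∘ₗ N k) (fun y y' => ind (Sk k) y * ind (Sk k) y' * (ε₀ * Real.exp (-(ρT * g.dist y y')))))
    -- per cube, IN THE CUBE's GAUGE: the cube's perturbation `V̂_k` of the jet (small on the cube's region), smallness, the `W`-rows, the flat nonlocal summand's commutator letters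
    (hV : ∀ k, HasMaj (BlockNorm.ofBlocks g (blkPair (liftBlk blk ι))) (BlockNorm.ofBlocks g (liftBlk blk ι)) (V k) (fun y y' => R * Real.exp (-(δV * g.dist y y'))))
    (hq : (β + (β₁ + ct * β)) * (R * cr) * cr < 1)
    (hW : ∀ k, HasMaj (BlockNorm.ofBlocks g (liftBlk blk ι)) (BlockNorm.ofBlocks g (liftBlk blk ι)) (commOp W (fun p : X × ι => hX k p.1) ∘ₗ (projO none ∘ₗ bgPropV (stack (mulOp (fun p : X × ι => χtX k p.1) ∘ₗ N k)
          (fun j => Sum.elim (fun μ => fgrad n (liftEquiv (τ μ) ι)) (fun μ => bgrad n (liftEquiv (τ μ) ι)) j ∘ₗ (mulOp (fun p : X × ι => χtX k p.1) ∘ₗ N k))) (V k)))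
      (fun y y' => ind (Sk k) y * ind (Sk k) y' * (θW * Real.exp (-(ρ₂ * g.dist y y')))))
    (hKN : ∀ k, HasMaj (BlockNorm.ofBlocks g (liftBlk blk ι)) (BlockNorm.ofBlocks g (liftBlk blk ι)) (commOp NL (fun p : X × ι => hX k p.1)) (fun y y' => cN * Real.exp (-(ρN * g.dist y y'))))
    -- per cube: the ORTHOGONAL SITE GAUGE `u_k` of (3.35), the GLOBAL operator `Δ` read in it = the cube's model operator up to a far defect `F_k`, and `F_k`'s two rows against the cube
    (hug : ∀ k x, ug k x * (ug k x)ᵀ = 1) (hug' : ∀ k x, (ug k x)ᵀ * ug k x = 1) (hθF : 0 ≤ θF) (hεF : 0 ≤ εF)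
    (hcov : ∀ k, mmulOp (ug k) ∘ₗ Δ ∘ₗ mmulOp (fun x => (ug k x)ᵀ) = (lapOp n (fun μ => liftEquiv (τ μ) ι) W + NL - V k ∘ₗ stack LinearMap.id (fun j => Sum.elim (fun μ => fgrad n (liftEquiv (τ μ) ι)) (fun μ => bgrad n (liftEquiv (τ μ) ι)) j)) + F k)
    (hFK : ∀ k, HasMaj (BlockNorm.ofBlocks g (liftBlk blk ι)) (BlockNorm.ofBlocks g (liftBlk blk ι)) (commOp (F k) (fun p : X × ι => hX k p.1) ∘ₗ (projO none ∘ₗ bgPropV (stack (mulOp (fun p : X × ι => χtX k p.1) ∘ₗ N k) (fun j => Sum.elim (fun μ => fgrad n (liftEquiv (τ μ) ι)) (fun μ => bgrad n (liftEquiv (τ μ) ι)) j ∘ₗ (mulOp (fun p : X × ι => χtX k p.1) ∘ₗ N k))) (V k)))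
      (fun y y' => ind (Sk k) y' * (θF * Real.exp (-(ρ₃ * g.dist y y')))))
    (hFX : ∀ k, HasMaj (BlockNorm.ofBlocks g (liftBlk blk ι)) (BlockNorm.ofBlocks g (liftBlk blk ι)) (mulOp (fun p : X × ι => hX k p.1) ∘ₗ F k ∘ₗ (projO none ∘ₗ bgPropV (stack (mulOp (fun p : X × ι => χtX k p.1) ∘ₗ N k) (fun j => Sum.elim (fun μ => fgrad n (liftEquiv (τ μ) ι)) (fun μ => bgrad n (liftEquiv (τ μ) ι)) j ∘ₗ (mulOp (fun p : X × ι => χtX k p.1) ∘ₗ N k))) (V k)))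
      (fun y y' => ind (Sk k) y * (εF * Real.exp (-(ρ₃ * g.dist y y')))))
    (hq' : Nov * ((Fintype.card ι : ℝ) ^ 2 * ((((Fintype.card J : ℝ) * (c₂ * ((β + (β₁ + ct * β)) * (1 - (β + (β₁ + ct * β)) * (R * cr) * cr)⁻¹) + 2 * (c₁ * ((β + (β₁ + ct * β)) * (1 - (β + (β₁ + ct * β)) * (R * cr) * cr)⁻¹))) + θW + cN * ((β + (β₁ + ct * β)) * (1 - (β + (β₁ + ct * β)) * (R * cr) * cr)⁻¹) * cr)
          + ((ℓ * (Real.exp 1 * ε)⁻¹ + 2 * (ω + ℓ * d₁)) * R * ((β + (β₁ + ct * β)) * (1 - (β + (β₁ + ct * β)) * (R * cr) * cr)⁻¹) * cr + R * c₁ * ((β + (β₁ + ct * β)) * (1 - (β + (β₁ + ct * β)) * (R * cr) * cr)⁻¹) * cr)) + θF) + (Fintype.card ι : ℝ) ^ 2 * ((ε₀ * (1 - (β + (β₁ + ct * β)) * (R * cr) * cr)⁻¹) + εF)) * cr < 1)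
    -- THE SECOND FAMILY: the same flat cubes, cuts, partition and tails, dressed by `V̂♭_k`, the global `Δ♭` read in the site gauges `u♭_k` with far defects `F♭_k` (same letters)
    (hV₂ : ∀ k, HasMaj (BlockNorm.ofBlocks g (blkPair (liftBlk blk ι))) (BlockNorm.ofBlocks g (liftBlk blk ι)) (V₂ k) (fun y y' => R * Real.exp (-(δV * g.dist y y'))))
    (hW₂ : ∀ k, HasMaj (BlockNorm.ofBlocks g (liftBlk blk ι)) (BlockNorm.ofBlocks g (liftBlk blk ι)) (commOp W (fun p : X × ι => hX k p.1) ∘ₗ (projO none ∘ₗ bgPropV (stack (mulOp (fun p : X × ι => χtX k p.1) ∘ₗ N k)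
          (fun j => Sum.elim (fun μ => fgrad n (liftEquiv (τ μ) ι)) (fun μ => bgrad n (liftEquiv (τ μ) ι)) j ∘ₗ (mulOp (fun p : X × ι => χtX k p.1) ∘ₗ N k))) (V₂ k)))
      (fun y y' => ind (Sk k) y * ind (Sk k) y' * (θW * Real.exp (-(ρ₂ * g.dist y y')))))
    (hug₂ : ∀ k x, ug₂ k x * (ug₂ k x)ᵀ = 1) (hug₂' : ∀ k x, (ug₂ k x)ᵀ * ug₂ k x = 1)
    (hcov₂ : ∀ k, mmulOp (ug₂ k) ∘ₗ Δ₂ ∘ₗ mmulOp (fun x => (ug₂ k x)ᵀ) = (lapOp n (fun μ => liftEquiv (τ μ) ι) W + NL - V₂ k ∘ₗ stack LinearMap.id (fun j => Sum.elim (fun μ => fgrad n (liftEquiv (τ μ) ι)) (fun μ => bgrad n (liftEquiv (τ μ) ι)) j)) + F₂ k)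
    (hFK₂ : ∀ k, HasMaj (BlockNorm.ofBlocks g (liftBlk blk ι)) (BlockNorm.ofBlocks g (liftBlk blk ι)) (commOp (F₂ k) (fun p : X × ι => hX k p.1) ∘ₗ (projO none ∘ₗ bgPropV (stack (mulOp (fun p : X × ι => χtX k p.1) ∘ₗ N k) (fun j => Sum.elim (fun μ => fgrad n (liftEquiv (τ μ) ι)) (fun μ => bgrad n (liftEquiv (τ μ) ι)) j ∘ₗ (mulOp (fun p : X × ι => χtX k p.1) ∘ₗ N k))) (V₂ k)))
      (fun y y' => ind (Sk k) y' * (θF * Real.exp (-(ρ₃ * g.dist y y')))))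
    (hFX₂ : ∀ k, HasMaj (BlockNorm.ofBlocks g (liftBlk blk ι)) (BlockNorm.ofBlocks g (liftBlk blk ι)) (mulOp (fun p : X × ι => hX k p.1) ∘ₗ F₂ k ∘ₗ (projO none ∘ₗ bgPropV (stack (mulOp (fun p : X × ι => χtX k p.1) ∘ₗ N k) (fun j => Sum.elim (fun μ => fgrad n (liftEquiv (τ μ) ι)) (fun μ => bgrad n (liftEquiv (τ μ) ι)) j ∘ₗ (mulOp (fun p : X × ι => χtX k p.1) ∘ₗ N k))) (V₂ k)))
      (fun y y' => ind (Sk k) y * (εF * Real.exp (-(ρ₃ * g.dist y y')))))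
    -- FAR ∕ NEAR: on the cubes not `Far` the site gauges agree; the far cubes' regions lie in `Z`
    (hZ : ∀ k, Far k → Sk k ⊆ Z) (hWW : ∀ k, ¬Far k → ug₂ k = ug k)
    -- THE CLOSENESS RADIUS: on the cubes not `Far` both dressings are `R_c`-small, `R_c ≤ R` (the Neumann radius)
    {Rc : ℝ} (hRc : 0 ≤ Rc) (hRcR : Rc ≤ R) (hVc : ∀ k, ¬Far k → HasMaj (BlockNorm.ofBlocks g (blkPair (liftBlk blk ι))) (BlockNorm.ofBlocks g (liftBlk blk ι)) (V k) (fun y y' => Rc * Real.exp (-(δV * g.dist y y'))))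
    (hVc₂ : ∀ k, ¬Far k → HasMaj (BlockNorm.ofBlocks g (blkPair (liftBlk blk ι))) (BlockNorm.ofBlocks g (liftBlk blk ι)) (V₂ k) (fun y y' => Rc * Real.exp (-(δV * g.dist y y')))) :
    HasMaj (BlockNorm.ofBlocks g (liftBlk blk ι)) (BlockNorm.ofBlocks g (liftBlk blk ι))
      ((glueInv (parametrix (fun k (p : X × ι) => hX k p.1) (fun k => mmulOp (fun x => (ug k x)ᵀ) ∘ₗ (projO none ∘ₗ bgPropV (stack (mulOp (fun p : X × ι => χtX k p.1) ∘ₗ N k) (fun j => Sum.elim (fun μ => fgrad n (liftEquiv (τ μ) ι)) (fun μ => bgrad n (liftEquiv (τ μ) ι)) j ∘ₗ (mulOp (fun p : X × ι => χtX k p.1) ∘ₗ N k))) (V k)) ∘ₗ mmulOp (ug k)))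
        (remainder Δ (fun k (p : X × ι) => hX k p.1) (fun k => mmulOp (fun x => (ug k x)ᵀ) ∘ₗ (projO none ∘ₗ bgPropV (stack (mulOp (fun p : X × ι => χtX k p.1) ∘ₗ N k) (fun j => Sum.elim (fun μ => fgrad n (liftEquiv (τ μ) ι)) (fun μ => bgrad n (liftEquiv (τ μ) ι)) j ∘ₗ (mulOp (fun p : X × ι => χtX k p.1) ∘ₗ N k))) (V k)) ∘ₗ mmulOp (ug k)) -
          ∑ k, (mmulOp (fun x => (ug k x)ᵀ) ∘ₗ ((((-(mulOp (fun p : X × ι => hX k p.1) ∘ₗ NL ∘ₗ mulOp (1 - fun p : X × ι => χtX k p.1))) ∘ₗ N k) ∘ₗ (LinearMap.id + (V k ∘ₗ stack LinearMap.id (fun j => Sum.elim (fun μ => fgrad n (liftEquiv (τ μ) ι)) (fun μ => bgrad n (liftEquiv (τ μ) ι)) j)) ∘ₗ (projO none ∘ₗ bgPropV (stack (mulOp (fun p : X × ι => χtX k p.1) ∘ₗ N k) (fun j => Sum.elim (fun μ => fgrad n (liftEquiv (τ μ) ι)) (fun μ => bgrad n (liftEquiv (τ μ) ι)) j ∘ₗ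 (mulOp (fun p : X × ι => χtX k p.1) ∘ₗ N k))) (V k))) + mulOp (fun p : X × ι => hX k p.1) ∘ₗ F k ∘ₗ (projO none ∘ₗ bgPropV (stack (mulOp (fun p : X × ι => χtX k p.1) ∘ₗ N k) (fun j => Sum.elim (fun μ => fgrad n (liftEquiv (τ μ) ι)) (fun μ => bgrad n (liftEquiv (τ μ) ι)) j ∘ₗ (mulOp (fun p : X × ι => χtX k p.1) ∘ₗ N k))) (V k)))) ∘ₗ mmulOp (ug k)) ∘ₗ mulOp (fun p : X × ι => hX k p.1))) -
        (glueInv (parametrix (fun k (p : X × ι) => hX k p.1) (fun k => mmulOp (fun x => (ug₂ k x)ᵀ) ∘ₗ (projO none ∘ₗ bgPropV (stack (mulOp (fun p : X × ι => χtX k p.1) ∘ₗ N k) (fun j => Sum.elim (fun μ => fgrad n (liftEquiv (τ μ) ι)) (fun μ => bgrad n (liftEquiv (τ μ) ι)) j ∘ₗ (mulOp (fun p : X × ι => χtX k p.1) ∘ₗ N k))) (V₂ k)) ∘ₗ mmulOp (ug₂ k)))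
        (remainder Δ₂ (fun k (p : X × ι) => hX k p.1) (fun k => mmulOp (fun x => (ug₂ k x)ᵀ) ∘ₗ (projO none ∘ₗ bgPropV (stack (mulOp (fun p : X × ι => χtX k p.1) ∘ₗ N k) (fun j => Sum.elim (fun μ => fgrad n (liftEquiv (τ μ) ι)) (fun μ => bgrad n (liftEquiv (τ μ) ι)) j ∘ₗ (mulOp (fun p : X × ι => χtX k p.1) ∘ₗ N k))) (V₂ k)) ∘ₗ mmulOp (ug₂ k)) -
          ∑ k, (mmulOp (fun x => (ug₂ k x)ᵀ) ∘ₗ ((((-(mulOp (fun p : X × ι => hX k p.1) ∘ₗ NL ∘ₗ mulOp (1 - fun p : X × ι => χtX k p.1))) ∘ₗ N k) ∘ₗ (LinearMap.id + (V₂ k ∘ₗ stack LinearMap.id (fun j => Sum.elim (fun μ => fgrad n (liftEquiv (τ μ) ι)) (fun μ => bgrad n (liftEquiv (τ μ) ι)) j)) ∘ₗ (projO none ∘ₗ bgPropV (stack (mulOp (fun p : X × ι => χtX k p.1) ∘ₗ N k) (fun j => Sum.elim (fun μ => fgrad n (liftEquiv (τ μ) ι)) (fun μ => bgrad n (liftEquiv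 (τ μ) ι)) j ∘ₗ (mulOp (fun p : X × ι => χtX k p.1) ∘ₗ N k))) (V₂ k))) + mulOp (fun p : X × ι => hX k p.1) ∘ₗ F₂ k ∘ₗ (projO none ∘ₗ bgPropV (stack (mulOp (fun p : X × ι => χtX k p.1) ∘ₗ N k) (fun j => Sum.elim (fun μ => fgrad n (liftEquiv (τ μ) ι)) (fun μ => bgrad n (liftEquiv (τ μ) ι)) j ∘ₗ (mulOp (fun p : X × ι => χtX k p.1) ∘ₗ N k))) (V₂ k)))) ∘ₗ mmulOp (ug₂ k)) ∘ₗ mulOp (fun p : X × ι => hX k p.1))))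
      (fun y y' => ((Nov * ((Fintype.card ι : ℝ) ^ 2 * (2 * ((β + (β₁ + ct * β)) * (Rc * ((β + (β₁ + ct * β)) * (1 - (β + (β₁ + ct * β)) * (R * cr) * cr)⁻¹) * cr) * cr))) + Nov * ((Fintype.card ι : ℝ) ^ 2 * ((β + (β₁ + ct * β)) * (1 - (β + (β₁ + ct * β)) * (R * cr) * cr)⁻¹)) * ((1 - Nov * ((Fintype.card ι : ℝ) ^ 2 * ((((Fintype.card J : ℝ) * (c₂ * ((β + (β₁ + ct * β)) * (1 - (β + (β₁ + ct * β)) * (R * cr) * cr)⁻¹) + 2 * (c₁ * ((β + (β₁ + ct * β)) * (1 - (β + (β₁ + ct * β)) * (R * cr) * cr)⁻¹))) + θW + cN * ((β + (β₁ + ct * β)) * (1 - (β + (β₁ + ct * β)) * (R * cr) * cr)⁻¹) * cr) + ((ℓ * (Real.exp 1 * ε)⁻¹ + 2 * (ω + ℓ * d₁)) * R * ((β + (β₁ + ct * β)) * (1 - (β + (β₁ + ct * β)) * (R * cr) * cr)⁻¹) * cr + R * c₁ * ((β + (β₁ + ct * β)) * (1 - (β + (β₁ + ct * β)) * (R * cr)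 * cr)⁻¹) * cr)) + θF) + (Fintype.card ι : ℝ) ^ 2 * ((ε₀ * (1 - (β + (β₁ + ct * β)) * (R * cr) * cr)⁻¹) + εF)) * cr)⁻¹ * cr) *
            (Nov * ((Fintype.card ι : ℝ) ^ 2 * (2 * ((((Fintype.card J : ℝ) * (c₂ * ((β + (β₁ + ct * β)) * (1 - (β + (β₁ + ct * β)) * (R * cr) * cr)⁻¹) + 2 * (c₁ * ((β + (β₁ + ct * β)) * (1 - (β + (β₁ + ct * β)) * (R * cr) * cr)⁻¹))) + θW + cN * ((β + (β₁ + ct * β)) * (1 - (β + (β₁ + ct * β)) * (R * cr) * cr)⁻¹) * cr) + ((ℓ * (Real.exp 1 * ε)⁻¹ + 2 * (ω + ℓ * d₁)) * R * ((β + (β₁ + ct * β)) * (1 - (β + (β₁ + ct * β)) * (R * cr) * cr)⁻¹) * cr + R * c₁ * ((β + (β₁ + ct * β)) * (1 - (β + (β₁ + ct * β)) * (R * cr) * cr)⁻¹) * cr)) + θF)) + (Fintype.card ι : ℝ) ^ 2 * (2 * ((ε₀ * (1 - (β + (β₁ + ct * β)) * (R * cr) * cr)⁻¹) + εF)))) *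 cr) * ((1 - Nov * ((Fintype.card ι : ℝ) ^ 2 * ((((Fintype.card J : ℝ) * (c₂ * ((β + (β₁ + ct * β)) * (1 - (β + (β₁ + ct * β)) * (R * cr) * cr)⁻¹) + 2 * (c₁ * ((β + (β₁ + ct * β)) * (1 - (β + (β₁ + ct * β)) * (R * cr) * cr)⁻¹))) + θW + cN * ((β + (β₁ + ct * β)) * (1 - (β + (β₁ + ct * β)) * (R * cr) * cr)⁻¹) * cr) + ((ℓ * (Real.exp 1 * ε)⁻¹ + 2 * (ω + ℓ * d₁)) * R * ((β + (β₁ + ct * β)) * (1 - (β + (β₁ + ct * β)) * (R * cr) * cr)⁻¹) * cr + R * c₁ * ((β + (β₁ + ct * β)) * (1 - (β + (β₁ + ct * β)) * (R * cr) * cr)⁻¹) * cr)) + θF) + (Fintype.card ι : ℝ) ^ 2 * ((ε₀ * (1 - (β + (β₁ + ct * β)) * (R * cr) * cr)⁻¹) + εF)) * cr)⁻¹ * cr) +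
          (Nov * (2 * ((Fintype.card ι : ℝ) ^ 2 * ((β + (β₁ + ct * β)) * (1 - (β + (β₁ + ct * β)) * (R * cr) * cr)⁻¹))) + Nov * ((Fintype.card ι : ℝ) ^ 2 * ((β + (β₁ + ct * β)) * (1 - (β + (β₁ + ct * β)) * (R * cr) * cr)⁻¹)) * ((1 - Nov * ((Fintype.card ι : ℝ) ^ 2 * ((((Fintype.card J : ℝ) * (c₂ * ((β + (β₁ + ct * β)) * (1 - (β + (β₁ + ct * β)) * (R * cr) * cr)⁻¹) + 2 * (c₁ * ((β + (β₁ + ct * β)) * (1 - (β + (β₁ + ct * β)) * (R * cr) * cr)⁻¹))) + θW + cN * ((β + (β₁ + ct * β)) * (1 - (β + (β₁ + ct * β)) * (R * cr) * cr)⁻¹) * cr) + ((ℓ * (Real.exp 1 * ε)⁻¹ + 2 * (ω + ℓ * d₁)) * R * ((β + (β₁ + ct * β)) * (1 - (β + (β₁ + ct * β)) * (R * cr) * cr)⁻¹) * cr + R * c₁ * ((β + (β₁ + ct * β)) * (1 - (β + (β₁ + ct * β)) * (R * cr) * cr)⁻¹) * cr)) + θF) + (Fintype.card ι : ℝ) ^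 2 * ((ε₀ * (1 - (β + (β₁ + ct * β)) * (R * cr) * cr)⁻¹) + εF)) * cr)⁻¹ * cr) *
            (Nov * (2 * ((Fintype.card ι : ℝ) ^ 2 * ((ε₀ * (1 - (β + (β₁ + ct * β)) * (R * cr) * cr)⁻¹) + εF))) + Nov * (2 * ((Fintype.card ι : ℝ) ^ 2 * ((((Fintype.card J : ℝ) * (c₂ * ((β + (β₁ + ct * β)) * (1 - (β + (β₁ + ct * β)) * (R * cr) * cr)⁻¹) + 2 * (c₁ * ((β + (β₁ + ct * β)) * (1 - (β + (β₁ + ct * β)) * (R * cr) * cr)⁻¹))) + θW + cN * ((β + (β₁ + ct * β)) * (1 - (β + (β₁ + ct * β)) * (R * cr) * cr)⁻¹) * cr) + ((ℓ * (Real.exp 1 * ε)⁻¹ + 2 * (ω + ℓ * d₁)) * R * ((β + (β₁ + ct * β)) * (1 - (β + (β₁ + ct * β)) * (R * cr) * cr)⁻¹) * cr + R * c₁ * ((β + (β₁ + ct * β)) * (1 - (β + (β₁ + ct * β)) * (R * cr) * cr)⁻¹) * cr)) + θF)))) * cr) *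
            ((1 - Nov * ((Fintype.card ι : ℝ) ^ 2 * ((((Fintype.card J : ℝ) * (c₂ * ((β + (β₁ + ct * β)) * (1 - (β + (β₁ + ct * β)) * (R * cr) * cr)⁻¹) + 2 * (c₁ * ((β + (β₁ + ct * β)) * (1 - (β + (β₁ + ct * β)) * (R * cr) * cr)⁻¹))) + θW + cN * ((β + (β₁ + ct * β)) * (1 - (β + (β₁ + ct * β)) * (R * cr) * cr)⁻¹) * cr) + ((ℓ * (Real.exp 1 * ε)⁻¹ + 2 * (ω + ℓ * d₁)) * R * ((β + (β₁ + ct * β)) * (1 - (β + (β₁ + ct * β)) * (R * cr) * cr)⁻¹) * cr + R * c₁ * ((β + (β₁ + ct * β)) * (1 - (β + (β₁ + ct * β)) * (R * cr) * cr)⁻¹) * cr)) + θF) + (Fintype.card ι : ℝ) ^ 2 * ((ε₀ * (1 - (β + (β₁ + ct * β)) * (R * cr) * cr)⁻¹) + εF)) * cr)⁻¹ * cr) * Real.exp (-((ρ₃ / 4 - σ) * dZ y))) *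
        Real.exp (-((ρ₃ / 4 - 2 * σ) * g.dist y y'))) := by
  have hβb : 0 ≤ (β + (β₁ + ct * β)) := by positivity
  have hqi : 0 ≤ (1 - (β + (β₁ + ct * β)) * (R * cr) * cr)⁻¹ := inv_nonneg.2 (by linarith)
  have hB : 0 ≤ ((β + (β₁ + ct * β)) * (1 - (β + (β₁ + ct * β)) * (R * cr) * cr)⁻¹) := mul_nonneg hβb hqi
  have hθ : 0 ≤ (((Fintype.card J : ℝ) * (c₂ * ((β + (β₁ + ct * β)) * (1 - (β + (β₁ + ct * β)) * (R * cr) * cr)⁻¹) + 2 * (c₁ * ((β + (β₁ + ct * β)) * (1 - (β + (β₁ + ct * β)) * (R * cr) * cr)⁻¹))) + θW + cN * ((β + (β₁ + ct * β)) * (1 - (β + (β₁ + ct * β)) * (R * cr) * cr)⁻¹) * cr)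
          + ((ℓ * (Real.exp 1 * ε)⁻¹ + 2 * (ω + ℓ * d₁)) * R * ((β + (β₁ + ct * β)) * (1 - (β + (β₁ + ct * β)) * (R * cr) * cr)⁻¹) * cr + R * c₁ * ((β + (β₁ + ct * β)) * (1 - (β + (β₁ + ct * β)) * (R * cr) * cr)⁻¹) * cr)) := by positivity
  have hε' : 0 ≤ (ε₀ * (1 - (β + (β₁ + ct * β)) * (R * cr) * cr)⁻¹) := mul_nonneg hε₀ hqi
  -- files 31∕34: flat letters of each smooth-cut cube and its jet; file 23: the Neumann series is summable
  have hG := fun k => hasMaj_smoothCut_flat blk (S := Sk k) hβ hβ₁ hct (hχt k) (hsub k) (hcut k)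
  have hD := fun k => hasMaj_jet_smoothCut_flat blk τ n (S := Sk k) hβ hβ₁ hct (hχt k) (hdχt k) (hdχtb k) (hs k) (hsb k) (hdd k) (hddb k) (hcut k) (hcutF k) (hcutB k)
  have hunit := fun k => (hasMaj_dressedV_pair blk htri hd hrow hσ hβb hR hcr hσρ hρ₁V hρ₁G hρ₂ hρ₂₁ (hG k) (hD k) (hV k) hq).1
  have hunit₂ := fun k => (hasMaj_dressedV_pair blk htri hd hrow hσ hβb hR hcr hσρ hρ₁V hρ₁G hρ₂ hρ₂₁ (hG k) (hD k) (hV₂ k) hq).1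
  -- file 34: the cut letter of each dressed cube (two-sided; `M_χX = X`), weakened to the rate `ρ₃`
  have hGc : ∀ k, HasMaj (BlockNorm.ofBlocks g (liftBlk blk ι)) (BlockNorm.ofBlocks g (liftBlk blk ι)) (mulOp (fun p : X × ι => χX k p.1) ∘ₗ (projO none ∘ₗ bgPropV (stack (mulOp (fun p : X × ι => χtX k p.1) ∘ₗ N k)
          (fun j => Sum.elim (fun μ => fgrad n (liftEquiv (τ μ) ι)) (fun μ => bgrad n (liftEquiv (τ μ) ι)) j ∘ₗ (mulOp (fun p : X × ι => χtX k p.1) ∘ₗ N k))) (V k)))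
      (fun y y' => ind (Sk k) y * ind (Sk k) y' * (((β + (β₁ + ct * β)) * (1 - (β + (β₁ + ct * β)) * (R * cr) * cr)⁻¹) * Real.exp (-(ρ₃ * g.dist y y')))) := fun k => by
    rw [mulOp_comp_smoothCutDressed τ n (hχ k) (hNψ k) (hunit k)]
    exact (hasMaj_smoothCutDressed_loc₂ blk τ n htri hd hrow hσ hβ hβ₁ hct hR hcr hσρ hρ₁V hρ₁G hρ₂ hρ₂₁ (hSχ k) (hSψ k) (hχt k) (hdχt k) (hdχtb k) (hsub k) (hχ k) (hs k)
      (hsb k) (hdd k) (hddb k) (hNψ k) (hcut k) (hcutF k) (hcutB k) (hV k) hq).mono fun y y' =>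
        weight_mul_exp_rate_mono (mul_nonneg (ind_nonneg _ _) (ind_nonneg _ _)) hB hρ₃₂ (hd y y')
  have hGc₂ : ∀ k, HasMaj (BlockNorm.ofBlocks g (liftBlk blk ι)) (BlockNorm.ofBlocks g (liftBlk blk ι)) (mulOp (fun p : X × ι => χX k p.1) ∘ₗ (projO none ∘ₗ bgPropV (stack (mulOp (fun p : X × ι => χtX k p.1) ∘ₗ N k)
          (fun j => Sum.elim (fun μ => fgrad n (liftEquiv (τ μ) ι)) (fun μ => bgrad n (liftEquiv (τ μ) ι)) j ∘ₗ (mulOp (fun p : X × ι => χtX k p.1) ∘ₗ N k))) (V₂ k)))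
      (fun y y' => ind (Sk k) y * ind (Sk k) y' * (((β + (β₁ + ct * β)) * (1 - (β + (β₁ + ct * β)) * (R * cr) * cr)⁻¹) * Real.exp (-(ρ₃ * g.dist y y')))) := fun k => by
    rw [mulOp_comp_smoothCutDressed τ n (hχ k) (hNψ k) (hunit₂ k)]
    exact (hasMaj_smoothCutDressed_loc₂ blk τ n htri hd hrow hσ hβ hβ₁ hct hR hcr hσρ hρ₁V hρ₁G hρ₂ hρ₂₁ (hSχ k) (hSψ k) (hχt k) (hdχt k) (hdχtb k) (hsub k) (hχ k) (hs k)
      (hsb k) (hdd k) (hddb k) (hNψ k) (hcut k) (hcutF k) (hcutB k) (hV₂ k) hq).mono fun y y' =>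
        weight_mul_exp_rate_mono (mul_nonneg (ind_nonneg _ _) (ind_nonneg _ _)) hB hρ₃₂ (hd y y')
  -- file 38: the input-localized remainder row of each dressed cube (dag-n15-w4's row), at the rate `ρ₃`
  have hK : ∀ k, HasMaj (BlockNorm.ofBlocks g (liftBlk blk ι)) (BlockNorm.ofBlocks g (liftBlk blk ι)) (commOp (lapOp n (fun μ => liftEquiv (τ μ) ι) W + NL - (V k) ∘ₗ stack LinearMap.id (fun j => Sum.elim (fun μ => fgrad n (liftEquiv (τ μ) ι)) (fun μ => bgrad n (liftEquiv (τ μ) ι)) j)) (fun p : X × ι => hX k p.1) ∘ₗ (projO none ∘ₗ bgPropV (stack (mulOp (fun p : X × ι => χtX k p.1) ∘ₗ N k)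
          (fun j => Sum.elim (fun μ => fgrad n (liftEquiv (τ μ) ι)) (fun μ => bgrad n (liftEquiv (τ μ) ι)) j ∘ₗ (mulOp (fun p : X × ι => χtX k p.1) ∘ₗ N k))) (V k)))
      (fun y y' => ind (Sk k) y' * ((((Fintype.card J : ℝ) * (c₂ * ((β + (β₁ + ct * β)) * (1 - (β + (β₁ + ct * β)) * (R * cr) * cr)⁻¹) + 2 * (c₁ * ((β + (β₁ + ct * β)) * (1 - (β + (β₁ + ct * β)) * (R * cr) * cr)⁻¹))) + θW + cN * ((β + (β₁ + ct * β)) * (1 - (β + (β₁ + ct * β)) * (R * cr) * cr)⁻¹) * cr)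
          + ((ℓ * (Real.exp 1 * ε)⁻¹ + 2 * (ω + ℓ * d₁)) * R * ((β + (β₁ + ct * β)) * (1 - (β + (β₁ + ct * β)) * (R * cr) * cr)⁻¹) * cr + R * c₁ * ((β + (β₁ + ct * β)) * (1 - (β + (β₁ + ct * β)) * (R * cr) * cr)⁻¹) * cr)) * Real.exp (-(ρ₃ * g.dist y y')))) := fun k =>
    hasMaj_commOp_cubeOp_smoothCutDressed_in blk τ n htri hd hsymm hrow hσ hβ hβ₁ hct hR hcr hσρ hρ₁V hρ₁G hρ₂ hρ₂₁ hρ₃ hρ₃₂ hρ₃V hρ₃N hε hc₁ hc₂ hθW hcN hℓ hω hd₁ (hSχ k)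
      (hSψ k) (hχt k) (hdχt k) (hdχtb k) (hsub k) (hχ k) (hs k) (hsb k) (hdd k) (hddb k) (hs' k) (hsb' k) (hdd' k) (hddb' k) (hNψ k) (hcut k) (hcutF k) (hcutB k) (hV k) hq
      (hh1 k) (hh1b k) (hh2 k) (hLip k) (hrh k) hstep (hW k) (hKN k)
  have hK₂ : ∀ k, HasMaj (BlockNorm.ofBlocks g (liftBlk blk ι)) (BlockNorm.ofBlocks g (liftBlk blk ι)) (commOp (lapOp n (fun μ => liftEquiv (τ μ) ι) W + NL - (V₂ k) ∘ₗ stack LinearMap.id (fun j => Sum.elim (fun μ => fgrad n (liftEquiv (τ μ) ι)) (fun μ => bgrad n (liftEquiv (τ μ) ι)) j)) (fun p : X × ι => hX k p.1) ∘ₗ (projO none ∘ₗ bgPropV (stack (mulOp (fun p : X × ι => χtX k p.1) ∘ₗ N k)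
          (fun j => Sum.elim (fun μ => fgrad n (liftEquiv (τ μ) ι)) (fun μ => bgrad n (liftEquiv (τ μ) ι)) j ∘ₗ (mulOp (fun p : X × ι => χtX k p.1) ∘ₗ N k))) (V₂ k)))
      (fun y y' => ind (Sk k) y' * ((((Fintype.card J : ℝ) * (c₂ * ((β + (β₁ + ct * β)) * (1 - (β + (β₁ + ct * β)) * (R * cr) * cr)⁻¹) + 2 * (c₁ * ((β + (β₁ + ct * β)) * (1 - (β + (β₁ + ct * β)) * (R * cr) * cr)⁻¹))) + θW + cN * ((β + (β₁ + ct * β)) * (1 - (β + (β₁ + ct * β)) * (R * cr) * cr)⁻¹) * cr)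
          + ((ℓ * (Real.exp 1 * ε)⁻¹ + 2 * (ω + ℓ * d₁)) * R * ((β + (β₁ + ct * β)) * (1 - (β + (β₁ + ct * β)) * (R * cr) * cr)⁻¹) * cr + R * c₁ * ((β + (β₁ + ct * β)) * (1 - (β + (β₁ + ct * β)) * (R * cr) * cr)⁻¹) * cr)) * Real.exp (-(ρ₃ * g.dist y y')))) := fun k =>
    hasMaj_commOp_cubeOp_smoothCutDressed_in blk τ n htri hd hsymm hrow hσ hβ hβ₁ hct hR hcr hσρ hρ₁V hρ₁G hρ₂ hρ₂₁ hρ₃ hρ₃₂ hρ₃V hρ₃N hε hc₁ hc₂ hθW hcN hℓ hω hd₁ (hSχ k)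
      (hSψ k) (hχt k) (hdχt k) (hdχtb k) (hsub k) (hχ k) (hs k) (hsb k) (hdd k) (hddb k) (hs' k) (hsb' k) (hdd' k) (hddb' k) (hNψ k) (hcut k) (hcutF k) (hcutB k) (hV₂ k) hq
      (hh1 k) (hh1b k) (hh2 k) (hLip k) (hrh k) hstep (hW₂ k) (hKN k)
  -- file 33: the locality defect's letter of each dressed cube (output-localized), weakened to the rate `ρ₃`
  have hE : ∀ k, HasMaj (BlockNorm.ofBlocks g (liftBlk blk ι)) (BlockNorm.ofBlocks g (liftBlk blk ι)) ((fun k => ((-(mulOp (fun p : X × ι => hX k p.1) ∘ₗ NL ∘ₗ mulOp (1 - fun p : X × ι => χtX k p.1))) ∘ₗ N k) ∘ₗ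
          (LinearMap.id + ((V k) ∘ₗ stack LinearMap.id (fun j => Sum.elim (fun μ => fgrad n (liftEquiv (τ μ) ι)) (fun μ => bgrad n (liftEquiv (τ μ) ι)) j)) ∘ₗ (projO none ∘ₗ bgPropV (stack (mulOp (fun p : X × ι => χtX k p.1) ∘ₗ N k)
          (fun j => Sum.elim (fun μ => fgrad n (liftEquiv (τ μ) ι)) (fun μ => bgrad n (liftEquiv (τ μ) ι)) j ∘ₗ (mulOp (fun p : X × ι => χtX k p.1) ∘ₗ N k))) (V k)))) k)
      (fun y y' => ind (Sk k) y * ((ε₀ * (1 - (β + (β₁ + ct * β)) * (R * cr) * cr)⁻¹) * Real.exp (-(ρ₃ * g.dist y y')))) := fun k =>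
    (hasMaj_dressedTail_out blk htri hd hrow hσ hβb hR hε₀ hcr hσρ hρ₁V hρ₁G hρ₂ hρ₂₁ hρ₂T (fun _ => rfl) (hG k) (hD k) (hV k) hq (hT k)).mono fun y y' =>
      weight_mul_exp_rate_mono (ind_nonneg _ _) hε' hρ₃₂ (hd y y')
  have hE₂ : ∀ k, HasMaj (BlockNorm.ofBlocks g (liftBlk blk ι)) (BlockNorm.ofBlocks g (liftBlk blk ι)) ((fun k => ((-(mulOp (fun p : X × ι => hX k p.1) ∘ₗ NL ∘ₗ mulOp (1 - fun p : X × ι => χtX k p.1))) ∘ₗ N k) ∘ₗ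
          (LinearMap.id + ((V₂ k) ∘ₗ stack LinearMap.id (fun j => Sum.elim (fun μ => fgrad n (liftEquiv (τ μ) ι)) (fun μ => bgrad n (liftEquiv (τ μ) ι)) j)) ∘ₗ (projO none ∘ₗ bgPropV (stack (mulOp (fun p : X × ι => χtX k p.1) ∘ₗ N k)
          (fun j => Sum.elim (fun μ => fgrad n (liftEquiv (τ μ) ι)) (fun μ => bgrad n (liftEquiv (τ μ) ι)) j ∘ₗ (mulOp (fun p : X × ι => χtX k p.1) ∘ₗ N k))) (V₂ k)))) k)
      (fun y y' => ind (Sk k) y * ((ε₀ * (1 - (β + (β₁ + ct * β)) * (R * cr) * cr)⁻¹) * Real.exp (-(ρ₃ * g.dist y y')))) := fun k =>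
    (hasMaj_dressedTail_out blk htri hd hrow hσ hβb hR hε₀ hcr hσρ hρ₁V hρ₁G hρ₂ hρ₂₁ hρ₂T (fun _ => rfl) (hG k) (hD k) (hV₂ k) hq (hT k)).mono fun y y' =>
      weight_mul_exp_rate_mono (ind_nonneg _ _) hε' hρ₃₂ (hd y y')
  -- the far defect `F_k` of the local-gauge operator: its two rows join the remainder row and the defect row
  have hK' : ∀ k, HasMaj (BlockNorm.ofBlocks g (liftBlk blk ι)) (BlockNorm.ofBlocks g (liftBlk blk ι)) (commOp (mmulOp (ug k) ∘ₗ Δ ∘ₗ mmulOp (fun x => (ug k x)ᵀ)) (fun p : X × ι => hX k p.1) ∘ₗ (projO none ∘ₗ bgPropV (stack (mulOp (fun p : X × ι => χtX k p.1) ∘ₗ N k) (fun j => Sum.elim (fun μ => fgrad n (liftEquiv (τ μ) ι)) (fun μ => bgrad n (liftEquiv (τ μ) ι)) j ∘ₗ (mulOp (fun p : X × ι => χtX k p.1) ∘ₗ N k))) (V k)))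
      (fun y y' => ind (Sk k) y' * (((((Fintype.card J : ℝ) * (c₂ * ((β + (β₁ + ct * β)) * (1 - (β + (β₁ + ct * β)) * (R * cr) * cr)⁻¹) + 2 * (c₁ * ((β + (β₁ + ct * β)) * (1 - (β + (β₁ + ct * β)) * (R * cr) * cr)⁻¹))) + θW + cN * ((β + (β₁ + ct * β)) * (1 - (β + (β₁ + ct * β)) * (R * cr) * cr)⁻¹) * cr)
          + ((ℓ * (Real.exp 1 * ε)⁻¹ + 2 * (ω + ℓ * d₁)) * R * ((β + (β₁ + ct * β)) * (1 - (β + (β₁ + ct * β)) * (R * cr) * cr)⁻¹) * cr + R * c₁ * ((β + (β₁ + ct * β)) * (1 - (β + (β₁ + ct * β)) * (R * cr) * cr)⁻¹) * cr)) + θF) * Real.exp (-(ρ₃ * g.dist y y')))) := fun k => by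
    rw [hcov k, show ∀ (A B : (X × ι → ℝ) →ₗ[ℝ] (X × ι → ℝ)) (a : X × ι → ℝ) (G : (X × ι → ℝ) →ₗ[ℝ] (X × ι → ℝ)), commOp (A + B) a ∘ₗ G = commOp A a ∘ₗ G + commOp B a ∘ₗ G from
      fun A B a G => by simp only [commOp, LinearMap.add_comp, LinearMap.comp_add, LinearMap.sub_comp]; abel]
    exact ((hK k).add (hFK k)).mono fun y y' => le_of_eq (by ring)
  have hK'₂ : ∀ k, HasMaj (BlockNorm.ofBlocks g (liftBlk blk ι)) (BlockNorm.ofBlocks g (liftBlk blk ι)) (commOp (mmulOp (ug₂ k) ∘ₗ Δ₂ ∘ₗ mmulOp (fun x => (ug₂ k x)ᵀ)) (fun p : X × ι => hX k p.1) ∘ₗ (projO none ∘ₗ bgPropV (stack (mulOp (fun p : X × ι => χtX k p.1) ∘ₗ N k) (fun j => Sum.elim (fun μ => fgrad n (liftEquiv (τ μ) ι)) (fun μ => bgrad n (liftEquiv (τ μ) ι)) j ∘ₗ (mulOp (fun p : X × ι => χtX k p.1) ∘ₗ N k))) (V₂ k)))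
      (fun y y' => ind (Sk k) y' * (((((Fintype.card J : ℝ) * (c₂ * ((β + (β₁ + ct * β)) * (1 - (β + (β₁ + ct * β)) * (R * cr) * cr)⁻¹) + 2 * (c₁ * ((β + (β₁ + ct * β)) * (1 - (β + (β₁ + ct * β)) * (R * cr) * cr)⁻¹))) + θW + cN * ((β + (β₁ + ct * β)) * (1 - (β + (β₁ + ct * β)) * (R * cr) * cr)⁻¹) * cr)
          + ((ℓ * (Real.exp 1 * ε)⁻¹ + 2 * (ω + ℓ * d₁)) * R * ((β + (β₁ + ct * β)) * (1 - (β + (β₁ + ct * β)) * (R * cr) * cr)⁻¹) * cr + R * c₁ * ((β + (β₁ + ct * β)) * (1 - (β + (β₁ + ct * β)) * (R * cr) * cr)⁻¹) * cr)) + θF) * Real.exp (-(ρ₃ * g.dist y y')))) := fun k => by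
    rw [hcov₂ k, show ∀ (A B : (X × ι → ℝ) →ₗ[ℝ] (X × ι → ℝ)) (a : X × ι → ℝ) (G : (X × ι → ℝ) →ₗ[ℝ] (X × ι → ℝ)), commOp (A + B) a ∘ₗ G = commOp A a ∘ₗ G + commOp B a ∘ₗ G from
      fun A B a G => by simp only [commOp, LinearMap.add_comp, LinearMap.comp_add, LinearMap.sub_comp]; abel]
    exact ((hK₂ k).add (hFK₂ k)).mono fun y y' => le_of_eq (by ring)
  have hE' : ∀ k, HasMaj (BlockNorm.ofBlocks g (liftBlk blk ι)) (BlockNorm.ofBlocks g (liftBlk blk ι)) (((-(mulOp (fun p : X × ι => hX k p.1) ∘ₗ NL ∘ₗ mulOp (1 - fun p : X × ι => χtX k p.1))) ∘ₗ N k) ∘ₗ (LinearMap.id + (V k ∘ₗ stack LinearMap.id (fun j => Sum.elim (fun μ => fgrad n (liftEquiv (τ μ) ι)) (fun μ => bgrad n (liftEquiv (τ μ) ι)) j)) ∘ₗ (projO none ∘ₗ bgPropV (stack (mulOp (fun p : X × ι => χtX k p.1) ∘ₗ N k) (fun j => Sum.elim (fun μ => fgrad n (liftEquiv (τ μ) ι))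 (fun μ => bgrad n (liftEquiv (τ μ) ι)) j ∘ₗ (mulOp (fun p : X × ι => χtX k p.1) ∘ₗ N k))) (V k))) + mulOp (fun p : X × ι => hX k p.1) ∘ₗ F k ∘ₗ (projO none ∘ₗ bgPropV (stack (mulOp (fun p : X × ι => χtX k p.1) ∘ₗ N k) (fun j => Sum.elim (fun μ => fgrad n (liftEquiv (τ μ) ι)) (fun μ => bgrad n (liftEquiv (τ μ) ι)) j ∘ₗ (mulOp (fun p : X × ι => χtX k p.1) ∘ₗ N k))) (V k)))
      (fun y y' => ind (Sk k) y * (((ε₀ * (1 - (β + (β₁ + ct * β)) * (R * cr) * cr)⁻¹) + εF) * Real.exp (-(ρ₃ * g.dist y y')))) := fun k =>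
    ((hE k).add (hFX k)).mono fun y y' => le_of_eq (by ring)
  have hE'₂ : ∀ k, HasMaj (BlockNorm.ofBlocks g (liftBlk blk ι)) (BlockNorm.ofBlocks g (liftBlk blk ι)) (((-(mulOp (fun p : X × ι => hX k p.1) ∘ₗ NL ∘ₗ mulOp (1 - fun p : X × ι => χtX k p.1))) ∘ₗ N k) ∘ₗ (LinearMap.id + (V₂ k ∘ₗ stack LinearMap.id (fun j => Sum.elim (fun μ => fgrad n (liftEquiv (τ μ) ι)) (fun μ => bgrad n (liftEquiv (τ μ) ι)) j)) ∘ₗ (projO none ∘ₗ bgPropV (stack (mulOp (fun p : X × ι => χtX k p.1) ∘ₗ N k) (fun j => Sum.elim (fun μ => fgrad n (liftEquiv (τ μ) ι)) (fun μ => bgrad n (liftEquiv (τ μ) ι)) j ∘ₗ (mulOp (fun p : X × ι => χtX k p.1) ∘ₗ N k))) (V₂ k))) + mulOp (fun p : X × ι => hX k p.1) ∘ₗ F₂ k ∘ₗ (projO none ∘ₗ bgPropV (stack (mulOp (fun p : X × ι => χtX k p.1) ∘ₗ N k) (fun j => Sum.elim (fun μ => fgrad n (liftEquiv (τ μ) ι))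 (fun μ => bgrad n (liftEquiv (τ μ) ι)) j ∘ₗ (mulOp (fun p : X × ι => χtX k p.1) ∘ₗ N k))) (V₂ k)))
      (fun y y' => ind (Sk k) y * (((ε₀ * (1 - (β + (β₁ + ct * β)) * (R * cr) * cr)⁻¹) + εF) * Real.exp (-(ρ₃ * g.dist y y')))) := fun k =>
    ((hE₂ k).add (hFX₂ k)).mono fun y y' => le_of_eq (by ring)
  -- n15-c∕293 §1: on the cubes not `Far` the two dressed cubes are `2β̄(R_cβ̄′c_r)c_r`-close (both are `(Ĝ_kV̂)X̂`-corrections of the same flat cube), weakened to the rate `ρ₃`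
  have hGG : ∀ k, ¬Far k → HasMaj (BlockNorm.ofBlocks g (liftBlk blk ι)) (BlockNorm.ofBlocks g (liftBlk blk ι)) (mulOp (fun p : X × ι => χX k p.1) ∘ₗ ((projO none ∘ₗ bgPropV (stack (mulOp (fun p : X × ι => χtX k p.1) ∘ₗ N k) (fun j => Sum.elim (fun μ => fgrad n (liftEquiv (τ μ) ι)) (fun μ => bgrad n (liftEquiv (τ μ) ι)) j ∘ₗ (mulOp (fun p : X × ι => χtX k p.1) ∘ₗ N k))) (V k)) - (projO none ∘ₗ bgPropV (stack (mulOp (fun p : X × ι => χtX k p.1) ∘ₗ N k) (fun j => Sum.elim (fun μ => fgrad n (liftEquiv (τ μ) ι)) (fun μ => bgrad n (liftEquiv (τ μ) ι)) j ∘ₗ (mulOp (fun p : X × ι => χtX k p.1) ∘ₗ N k))) (V₂ k))))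
      (fun y y' => ind (Sk k) y * ind (Sk k) y' * ((2 * ((β + (β₁ + ct * β)) * (Rc * ((β + (β₁ + ct * β)) * (1 - (β + (β₁ + ct * β)) * (R * cr) * cr)⁻¹) * cr) * cr)) * Real.exp (-(ρ₃ * g.dist y y')))) := fun k hk =>
    (hasMaj_smoothCutDressed_sub_loc₂ blk τ n htri hd hrow hσ hβ hβ₁ hct hRc hRcR hcr hσρ hρ₁V hρ₁G hρ₂ hρ₂₁ (hSχ k) (hSψ k) (hχt k) (hdχt k) (hdχtb k) (hsub k) (hχ k) (hs k) (hsb k)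
      (hdd k) (hddb k) (hNψ k) (hcut k) (hcutF k) (hcutB k) (hVc k hk) (hVc₂ k hk) hq).mono fun y y' =>
        weight_mul_exp_rate_mono (mul_nonneg (ind_nonneg _ _) (ind_nonneg _ _)) (mul_nonneg zero_le_two (mul_nonneg (mul_nonneg hβb (mul_nonneg (mul_nonneg hRc hB) hcr)) hcr)) hρ₃₂ (hd y y')
  -- n15-c∕292: walk locality of FILE 46's glued operator with close near data (remainder and defect rows are small in BOTH families: closeness `2θ₀`, `2ε`)
  have hfin := hasMaj_glued_sub_glued_of_localGauges_close blk Sk ug Δ Δ₂ hX χX (fun k => projO none ∘ₗ bgPropV (stack (mulOp (fun p : X × ι => χtX k p.1) ∘ₗ N k) (fun j => Sum.elim (fun μ => fgrad n (liftEquiv (τ μ) ι)) (fun μ => bgrad n (liftEquiv (τ μ) ι)) j ∘ₗ (mulOp (fun p : X × ι => χtX k p.1) ∘ₗ N k))) (V k)) (fun k => projO none ∘ₗ bgPropV (stack (mulOp (fun p : X × ι => χtX k p.1) ∘ₗ N k) (fun j => Sum.elim (fun μ => fgrad n (liftEquiv (τ μ) ι)) (fun μ => bgrad n (liftEquiv (τ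 μ) ι)) j ∘ₗ (mulOp (fun p : X × ι => χtX k p.1) ∘ₗ N k))) (V₂ k))
    (fun k => (((-(mulOp (fun p : X × ι => hX k p.1) ∘ₗ NL ∘ₗ mulOp (1 - fun p : X × ι => χtX k p.1))) ∘ₗ N k) ∘ₗ (LinearMap.id + (V k ∘ₗ stack LinearMap.id (fun j => Sum.elim (fun μ => fgrad n (liftEquiv (τ μ) ι)) (fun μ => bgrad n (liftEquiv (τ μ) ι)) j)) ∘ₗ (projO none ∘ₗ bgPropV (stack (mulOp (fun p : X × ι => χtX k p.1) ∘ₗ N k) (fun j => Sum.elim (fun μ => fgrad n (liftEquiv (τ μ) ι)) (fun μ => bgrad n (liftEquiv (τ μ) ι)) j ∘ₗ (mulOp (fun p : X × ι => χtX k p.1) ∘ₗ N k))) (V k))) + mulOp (fun p : X × ι => hX k p.1) ∘ₗ F k ∘ₗ (projO none ∘ₗ bgPropV (stack (mulOp (fun p : X × ι => χtX k p.1) ∘ₗ N k) (fun j => Sum.elim (fun μ => fgrad n (liftEquiv (τ μ) ι)) (fun μ => bgrad n (liftEquiv (τ μ) ι)) j ∘ₗ (mulOp (fun p : X × ι =>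 χtX k p.1) ∘ₗ N k))) (V k)))) (fun k => (((-(mulOp (fun p : X × ι => hX k p.1) ∘ₗ NL ∘ₗ mulOp (1 - fun p : X × ι => χtX k p.1))) ∘ₗ N k) ∘ₗ (LinearMap.id + (V₂ k ∘ₗ stack LinearMap.id (fun j => Sum.elim (fun μ => fgrad n (liftEquiv (τ μ) ι)) (fun μ => bgrad n (liftEquiv (τ μ) ι)) j)) ∘ₗ (projO none ∘ₗ bgPropV (stack (mulOp (fun p : X × ι => χtX k p.1) ∘ₗ N k) (fun j => Sum.elim (fun μ => fgrad n (liftEquiv (τ μ) ι)) (fun μ => bgrad n (liftEquiv (τ μ) ι)) j ∘ₗ (mulOp (fun p : X × ι => χtX k p.1) ∘ₗ N k))) (V₂ k))) + mulOp (fun p : X × ι => hX k p.1) ∘ₗ F₂ k ∘ₗ (projO none ∘ₗ bgPropV (stack (mulOp (fun p : X × ι => χtX k p.1) ∘ₗ N k) (fun j => Sum.elim (fun μ => fgrad n (liftEquiv (τ μ) ι)) (fun μ => bgrad n (liftEquiv (τ μ) ι)) j ∘ₗ (mulOp (fun p : X × ι => χtX k p.1) ∘ₗ N k))) (V₂ k))))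 ug₂ Far Z dZ htri hd hd0 hrow hσ hcr hdZ hdZ0 hug hug' hug₂ hug₂' (εG := 2 * ((β + (β₁ + ct * β)) * (Rc * ((β + (β₁ + ct * β)) * (1 - (β + (β₁ + ct * β)) * (R * cr) * cr)⁻¹) * cr) * cr))
    (εK := 2 * ((((Fintype.card J : ℝ) * (c₂ * ((β + (β₁ + ct * β)) * (1 - (β + (β₁ + ct * β)) * (R * cr) * cr)⁻¹) + 2 * (c₁ * ((β + (β₁ + ct * β)) * (1 - (β + (β₁ + ct * β)) * (R * cr) * cr)⁻¹))) + θW + cN * ((β + (β₁ + ct * β)) * (1 - (β + (β₁ + ct * β)) * (R * cr) * cr)⁻¹) * cr) + ((ℓ * (Real.exp 1 * ε)⁻¹ + 2 * (ω + ℓ * d₁)) * R * ((β + (β₁ + ct * β)) * (1 - (β + (β₁ + ct * β)) * (R * cr) * cr)⁻¹) * cr + R * c₁ * ((β + (β₁ + ct * β)) * (1 - (β + (β₁ + ct * β)) * (R * cr) * cr)⁻¹) * cr)) + θF)) (εE := 2 * ((ε₀ * (1 - (β + (β₁ + ct * β)) * (R * cr) * cr)⁻¹) + εF)) hB (add_nonneg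 hθ hθF) (add_nonneg hε' hεF) (mul_nonneg zero_le_two (mul_nonneg (mul_nonneg hβb (mul_nonneg (mul_nonneg hRc hB) hcr)) hcr))
    (mul_nonneg zero_le_two (add_nonneg hθ hθF)) (mul_nonneg zero_le_two (add_nonneg hε' hεF)) hNov hσρ₃ hhcut (fun k p => hhabs k p.1) hN hZ hWW hGc hGc₂ hK' hK'₂ hE' hE'₂ hGG
    (fun k hk => by have h₂ := hK'₂ k; rw [hWW k hk] at h₂; exact ((hK' k).sub h₂).mono fun y y' => le_of_eq (by ring)) (fun k _ => ((hE' k).sub (hE'₂ k)).mono fun y y' => le_of_eq (by ring)) hq'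
  exact hfin

end Glue

end Summit.QuantumFields.YangMills.BalabanUVNodes.N15.CurvedSpecies

end
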